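import Mathlib.MeasureTheory.Measure.Lebesgue.EqHaar
import Summits.AtomisticToContinuum.HydrodynamicLimit.Theorems.CollisionIsometryCLTHsFreeEnergyConvexBasic
import Literature.Analysis.FluidPDE.HardSphereTorusMeasure
import Literature.Analysis.FluidPDE.HardSpherePhaseSpaceProofs
import HarnessLib

/-!
# Free volume in a small cube of the torus versus the rescaled torus free volume

Stub `fv_cube_to_torus` (S3b) of the sub-cube decomposition lower bound behind
`stub_hsFreeEnergyConvex` (line `IdeatorTwoGen1Sketch` of the crux `MacroClosure`,
stmt-AtomisticToContinuum-14870): for `0 < s < 1/2`, a centre `c ∈ 𝕋³` and an exclusion distance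
`e`,

`s^{3n} · vol (posDomain (e/s) n) ≤ vol {x : Fin n → 𝕋³ | every xᵢ lies in the closed cube of
side s centred at c, and dist(xᵢ, xⱼ) ≥ e for i ≠ j}`

(Haar probability volumes on `(𝕋³)^n`, minimal-image distance `Torus.euclidDist`).

Proof: three changes of variables through Lebesgue measure on `(ℝ³)^n`.
* The covering map `w ↦ (proj wᵢ)ᵢ` is measure preserving from Lebesgue measure on the unit cube
  `((-1/2, 1/2]³)^n` to Haar measure (`Torus.map_proj_volume_restrict_symCube`,
  `measurePreserving_pi`) and does not increase distances
  (`Torus.euclidDist_proj_le_norm_sub_holds`), so the torus free volume `vol (posDomain (e/s) n)`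
  is at most the Euclidean free volume of the unit cube at exclusion `e/s`
  (`FvCubeToTorus.volume_posDomain_le`).
* Lebesgue scaling `vol (s • A) = s^{3n} vol A` (`Measure.addHaar_smul_of_nonneg`), and `s •` maps
  the unit-cube constraint set at exclusion `e/s` into the side-`s` constraint set at exclusion `e`.
* The chart `x ↦ (reprSym (xᵢ - c))ᵢ` is measure preserving from Haar measure to Lebesgue measure
  on the unit cube (`Torus.measurePreserving_reprSym`, `measurePreserving_sub_right`,
  `measurePreserving_pi`), and inside a cube of side `s < 1/2` the minimal-image distance *is* the
  Euclidean distance of the chart (`Torus.reprSym_add_proj`), so the side-`s` Euclidean constraint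
  set has the Haar volume of its preimage, which lies in the target set
  (`FvCubeToTorus.volume_constraint_le`).
-/

open MeasureTheory Filter Set Topology
open scoped ENNReal Pointwise

namespace Summit.AtomisticToContinuum.HydrodynamicLimit.Theorems.MacroClosureLine

open Literature.MathematicalPhysics.KineticTheory Literature.Analysis.FluidPDE
open Literature.Analysis.FunctionSpaces

namespace Barycentric

namespace FvCubeToTorus

/-- In a cube of side `s < 1/2` the symmetric representative is additive:
`reprSym (a - b) = reprSym a - reprSym b` when all coordinates of `reprSym a` and `reprSym b` are
at most `s/2` in absolute value. [folklore] -/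
theorem reprSym_sub_eq {a b : T3} {s : ℝ} (hs : s < 1 / 2)
    (ha : ∀ l, |Torus.reprSym a l| ≤ s / 2) (hb : ∀ l, |Torus.reprSym b l| ≤ s / 2) :
    Torus.reprSym (a - b) = Torus.reprSym a - Torus.reprSym b := by
  have h : a - b = a + Torus.proj (-Torus.reprSym b) := by
    rw [Torus.proj_neg, Torus.proj_reprSym, sub_eq_add_neg]
  rw [h, Torus.reprSym_add_proj, sub_eq_add_neg]
  intro l
  have h1 := abs_le.1 (ha l)
  have h2 := abs_le.1 (hb l)
  rw [PiLp.neg_apply]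
  constructor <;> linarith [h1.1, h1.2, h2.1, h2.2]

/-- In a cube of side `s < 1/2` centred at `c` the minimal-image distance is the Euclidean
distance of the chart `x ↦ reprSym (x - c)`. [folklore] -/
theorem euclidDist_eq_norm_sub {x y c : T3} {s : ℝ} (hs : s < 1 / 2)
    (hx : ∀ l, |Torus.reprSym (x - c) l| ≤ s / 2) (hy : ∀ l, |Torus.reprSym (y - c) l| ≤ s / 2) :
    Torus.euclidDist x y = ‖Torus.reprSym (x - c) - Torus.reprSym (y - c)‖ := by
  rw [Torus.euclidDist_eq, ← reprSym_sub_eq hs hx hy, sub_sub_sub_cancel_right]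

/-- The Euclidean constraint sets `{v | ∀ i l, |v i l| ≤ t} ∩ {v | ∀ i ≠ i', r ≤ ‖v i - v i'‖}`
of `(ℝ³)^n` are closed, hence measurable. [folklore] -/
theorem measurableSet_constraint (n : ℕ) (t r : ℝ) :
    MeasurableSet {v : Fin n → V3 | (∀ i l, |v i l| ≤ t) ∧ ∀ i i', i ≠ i' → r ≤ ‖v i - v i'‖} := by
  refine IsClosed.measurableSet ?_
  simp only [Set.setOf_and, Set.setOf_forall]
  refine IsClosed.inter (isClosed_iInter fun i => isClosed_iInter fun l => ?_)
    (isClosed_iInter fun i => isClosed_iInter fun i' => isClosed_iInter fun _ => ?_)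
  · exact isClosed_le (by fun_prop) continuous_const
  · exact isClosed_le continuous_const (by fun_prop)

/-- Lebesgue measure on `(ℝ³)^n` scales by `s^{3n}` under the homothety of ratio `s ≥ 0`.
[folklore] -/
theorem volume_smul_set (n : ℕ) {s : ℝ} (hs : 0 ≤ s) (A : Set (Fin n → V3)) :
    volume (s • A) = ENNReal.ofReal (s ^ (3 * n)) * volume A := by
  have hfin : Module.finrank ℝ (Fin n → V3) = 3 * n := by
    rw [Module.finrank_pi_fintype, finrank_euclideanSpace, Fintype.card_fin, Finset.sum_const,
      Finset.card_univ, Fintype.card_fin, smul_eq_mul, mul_comm]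
  rw [Measure.addHaar_smul_of_nonneg volume hs, hfin]

/-- **The torus free volume read in the unit cube.** The covering map `w ↦ (proj wᵢ)ᵢ` is
measure preserving from Lebesgue measure on `((-1/2, 1/2]³)^n` to Haar measure on `(𝕋³)^n` and
does not increase distances, so `vol (posDomain r n)` is at most the Lebesgue measure of the
Euclidean constraint set of the closed unit cube at exclusion `r`. [folklore] -/
theorem volume_posDomain_le (n : ℕ) (r : ℝ) :
    volume (posDomain r n) ≤
      volume {w : Fin n → V3 | (∀ i l, |w i l| ≤ 1 / 2) ∧ ∀ i i', i ≠ i' → r ≤ ‖w i - w i'‖} := by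
  have hP : MeasurePreserving (fun (w : Fin n → V3) (i : Fin n) => Torus.proj (w i))
      (Measure.pi fun _ : Fin n => (volume : Measure V3).restrict (Torus.symCube (Fin 3)))
      (volume : Measure (Fin n → T3)) :=
    measurePreserving_pi
      (fun _ : Fin n => (volume : Measure V3).restrict (Torus.symCube (Fin 3)))
      (fun _ => (volume : Measure T3)) (f := fun (_ : Fin n) (w : V3) => Torus.proj w)
      fun _ => ⟨Torus.measurable_proj, Torus.map_proj_volume_restrict_symCube⟩
  have hQmeas : MeasurableSet (Set.univ.pi fun _ : Fin n => Torus.symCube (Fin 3)) :=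
    MeasurableSet.univ_pi fun _ => Torus.measurableSet_symCube
  rw [show (volume : Measure (Fin n → V3)) = Measure.pi fun _ => volume from rfl,
    ← hP.measure_preimage (measurableSet_posDomain r n).nullMeasurableSet,
    ← Measure.restrict_pi_pi, Measure.restrict_apply' hQmeas]
  refine measure_mono ?_
  rintro w ⟨hD, hwQ⟩
  have hwQ' : ∀ i l, w i l ∈ Ioc (-(1 / 2 : ℝ)) (1 / 2) := fun i l =>
    (Set.mem_univ_pi.1 hwQ i : w i ∈ Torus.symCube (Fin 3)) l
  refine ⟨fun i l => abs_le.2 ⟨by linarith [(hwQ' i l).1], (hwQ' i l).2⟩, fun i i' hii' => ?_⟩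
  exact (hD i i' hii').trans (Torus.euclidDist_proj_le_norm_sub_holds (w i) (w i'))

/-- **Scaling.** The homothety of ratio `s > 0` maps the unit-cube constraint set at exclusion
`e / s` into the side-`s` constraint set at exclusion `e`. [folklore] -/
theorem smul_set_subset (n : ℕ) {s : ℝ} (e : ℝ) (hs : 0 < s) :
    s • {w : Fin n → V3 | (∀ i l, |w i l| ≤ 1 / 2) ∧ ∀ i i', i ≠ i' → e / s ≤ ‖w i - w i'‖} ⊆
      {v : Fin n → V3 | (∀ i l, |v i l| ≤ s / 2) ∧ ∀ i i', i ≠ i' → e ≤ ‖v i - v i'‖} := by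
  intro v hv
  obtain ⟨w, hw, rfl⟩ := Set.mem_smul_set.1 hv
  refine ⟨fun i l => ?_, fun i i' hii' => ?_⟩
  · rw [Pi.smul_apply, PiLp.smul_apply, smul_eq_mul, abs_mul, abs_of_pos hs]
    have := hw.1 i l
    nlinarith
  · rw [Pi.smul_apply, Pi.smul_apply, ← smul_sub, norm_smul, Real.norm_of_nonneg hs.le]
    have := (div_le_iff₀ hs).1 (hw.2 i i' hii')
    linarith

/-- **The chart.** `x ↦ (reprSym (xᵢ - c))ᵢ` is measure preserving from Haar measure on `(𝕋³)^n`
to Lebesgue measure on `((-1/2, 1/2]³)^n`, and in the cube of side `s < 1/2` centred at `c` the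
minimal-image distance is the Euclidean distance of the chart; hence the Lebesgue measure of the
side-`s` constraint set at exclusion `e` is at most the Haar measure of the set of `n` points of
the cube that are pairwise `e`-separated on the torus. [folklore] -/
theorem volume_constraint_le (n : ℕ) (c : T3) {s : ℝ} (e : ℝ) (hs : s < 1 / 2) :
    volume {v : Fin n → V3 | (∀ i l, |v i l| ≤ s / 2) ∧ ∀ i i', i ≠ i' → e ≤ ‖v i - v i'‖} ≤
      volume {x : Fin n → T3 | (∀ i l, |Torus.reprSym (x i - c) l| ≤ s / 2) ∧
        ∀ i i', i ≠ i' → e ≤ Torus.euclidDist (x i) (x i')} := by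
  have hR : MeasurePreserving (fun (x : Fin n → T3) (i : Fin n) => Torus.reprSym (x i - c))
      (volume : Measure (Fin n → T3))
      (Measure.pi fun _ : Fin n => (volume : Measure V3).restrict (Torus.symCube (Fin 3))) :=
    measurePreserving_pi (fun _ : Fin n => (volume : Measure T3))
      (fun _ => (volume : Measure V3).restrict (Torus.symCube (Fin 3)))
      (f := fun (_ : Fin n) (y : T3) => Torus.reprSym (y - c))
      fun _ => Torus.measurePreserving_reprSym.comp (measurePreserving_sub_right volume c)
  have hQmeas : MeasurableSet (Set.univ.pi fun _ : Fin n => Torus.symCube (Fin 3)) :=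
    MeasurableSet.univ_pi fun _ => Torus.measurableSet_symCube
  have hVQ : {v : Fin n → V3 | (∀ i l, |v i l| ≤ s / 2) ∧ ∀ i i', i ≠ i' → e ≤ ‖v i - v i'‖} ⊆
      Set.univ.pi fun _ : Fin n => Torus.symCube (Fin 3) := by
    intro v hv
    refine Set.mem_univ_pi.2 fun i l => ?_
    have h1 := abs_le.1 (hv.1 i l)
    exact ⟨by linarith [h1.1], by linarith [h1.2]⟩
  rw [← inter_eq_left.2 hVQ, ← Measure.restrict_apply' hQmeas,
    show (volume : Measure (Fin n → V3)) = Measure.pi fun _ => volume from rfl,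
    Measure.restrict_pi_pi,
    ← hR.measure_preimage (measurableSet_constraint n (s / 2) e).nullMeasurableSet]
  refine measure_mono fun x hx => ?_
  simp only [Set.mem_preimage, Set.mem_setOf_eq] at hx
  refine ⟨hx.1, fun i i' hii' => ?_⟩
  rw [euclidDist_eq_norm_sub hs (hx.1 i) (hx.1 i')]
  exact hx.2 i i' hii'

end FvCubeToTorus

open FvCubeToTorus in
/-- **S3b: the free volume of a small cube of the torus dominates the rescaled torus free
volume.** For `0 < s < 1/2`, `c ∈ 𝕋³` and `e ≥ 0`, the Haar measure of the set of `n` labelled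
points of the closed cube of side `s` centred at `c` that are pairwise at minimal-image distance
`≥ e` is at least `s^{3n}` times the Haar measure of the non-overlap set `posDomain (e/s) n` of
`n` points of the whole torus at exclusion `e/s` (chart by `reprSym`, Lebesgue scaling, and the
distance-non-increasing covering map `proj`). [folklore] -/
theorem fv_cube_to_torus : ∀ (n : ℕ) (c : T3) (s e : ℝ), 0 < s → s < 1 / 2 → 0 ≤ e → s ^ (3 * n) * (volume (posDomain (e / s) n)).toReal ≤ (volume {x : Fin n → T3 | (∀ i l, |Torus.reprSym (x i - c) l| ≤ s / 2) ∧ ∀ i i', i ≠ i' → e ≤ Torus.euclidDist (x i) (x i')}).toReal := by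
  intro n c s e hs hs2 _
  have key : ENNReal.ofReal (s ^ (3 * n)) * volume (posDomain (e / s) n) ≤
      volume {x : Fin n → T3 | (∀ i l, |Torus.reprSym (x i - c) l| ≤ s / 2) ∧
        ∀ i i', i ≠ i' → e ≤ Torus.euclidDist (x i) (x i')} :=
    calc ENNReal.ofReal (s ^ (3 * n)) * volume (posDomain (e / s) n)
        ≤ ENNReal.ofReal (s ^ (3 * n)) * volume {w : Fin n → V3 | (∀ i l, |w i l| ≤ 1 / 2) ∧
            ∀ i i', i ≠ i' → e / s ≤ ‖w i - w i'‖} :=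
          mul_le_mul_right (volume_posDomain_le n (e / s)) _
      _ = volume (s • {w : Fin n → V3 | (∀ i l, |w i l| ≤ 1 / 2) ∧
            ∀ i i', i ≠ i' → e / s ≤ ‖w i - w i'‖}) := (volume_smul_set n hs.le _).symm
      _ ≤ volume {v : Fin n → V3 | (∀ i l, |v i l| ≤ s / 2) ∧ ∀ i i', i ≠ i' → e ≤ ‖v i - v i'‖} :=
          measure_mono (smul_set_subset n e hs)
      _ ≤ _ := volume_constraint_le n c e hs2
  have hfin : volume {x : Fin n → T3 | (∀ i l, |Torus.reprSym (x i - c) l| ≤ s / 2) ∧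
      ∀ i i', i ≠ i' → e ≤ Torus.euclidDist (x i) (x i')} ≠ ∞ := measure_ne_top _ _
  have h := ENNReal.toReal_mono hfin key
  rwa [ENNReal.toReal_mul, ENNReal.toReal_ofReal (pow_nonneg hs.le _)] at h

end Barycentric

end Summit.AtomisticToContinuum.HydrodynamicLimit.Theorems.MacroClosureLine
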